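import Summits.HodgeConjecture.HodgeConjecture.Theorems.HodgeLocusCensusQuarticDense
import HarnessLib

/-!
# HodgeLocusCensusQuarticStack — STACKED rank certificates for two single-plane period matrices of the Fermat quartic sixfold, and certificates
checked in two chunks (cell pub-hlocus, lead seat ivhs-1, gen 6)
HONEST FRAMING: certified instances and evidence bearing on the general Hodge conjecture; no claim.

(1) Generic split support for `Z8Cert.Cert`: the row check (U) of a certificate depends on it only through `r` and `rhoD` (`pU_congr`), so (U)
for a row list `rows₁ ++ rows₂` follows from (U) of a chunk certificate on `rows₁` and a direct check of the remaining row expressions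
(`validU_append`) — this keeps every data file below the per-file elaboration budget.
(2) The (6,4) STACKED instance: for two signed-plane lists L₁, L₂ (`QDense.QPlane`, block-standard matchings) the 532 × 266 matrix
[M_{δ₁} ; M_{δ₂}] of the two period matrices `ivhsMatrix 6 4 ζ δᵢ` stacked (`Matrix.fromRows`) is the evaluation at ζ of
`fS L₁ L₂ (rowsS[a]) (idxL[b])` with `rowsS` = the 266 row indices tagged `false` followed by the same tagged `true`; `stackRank_of_qcert` turns a
valid certificate into `rank [M_{δ₁} ; M_{δ₂}] = Ψ.r` over every characteristic-0 field with a primitive 8th root of unity. This rank is the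
codimension of the intersection of the Zariski tangent spaces of the two Hodge loci V_{δ₁}, V_{δ₂} at the Fermat point (each being the kernel of
its own period matrix, [Movasati2016Periods, Thm. 6]).
(3) The single signed planes P0 (`planeStdL`), Ptwo (`planeTwoL`), P̌₁ (`planeStdTwistL`) as data.
-/

namespace Summit.HodgeConjecture.HodgeConjecture.HodgeLocus.Census.Z8Cert

open PlaneSum

/-- `allIx2` over a concatenation (first chunk with matching lengths) from its two chunks. -/
theorem allIx2_append {α β : Type*} (dy : β) (p : ℕ → α → β → Bool) :
    ∀ (i : ℕ) (xs₁ : List α) (ys₁ : List β) (xs₂ : List α) (ys₂ : List β), xs₁.length = ys₁.length →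
      allIx2 dy p i xs₁ ys₁ = true → allIx2 dy p (i + xs₁.length) xs₂ ys₂ = true →
      allIx2 dy p i (xs₁ ++ xs₂) (ys₁ ++ ys₂) = true
  | i, [], [], xs₂, ys₂, _, _, h₂ => by simpa using h₂
  | _, [], _ :: _, _, _, hl, _, _ => absurd hl (by simp)
  | _, _ :: _, [], _, _, hl, _, _ => absurd hl (by simp)
  | i, x :: xs₁, y :: ys₁, xs₂, ys₂, hl, h₁, h₂ => by
    rw [allIx2, Bool.and_eq_true] at h₁
    rw [List.cons_append, List.cons_append, allIx2, Bool.and_eq_true]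
    refine ⟨h₁.1, allIx2_append dy p (i + 1) xs₁ ys₁ xs₂ ys₂ (by simpa using hl) h₁.2 ?_⟩
    rw [show i + 1 + xs₁.length = i + (x :: xs₁).length by simp; omega]
    exact h₂

namespace Cert

variable {RD CD : Type*} [Inhabited RD] (Ψ : Cert RD CD)

/-- the row check depends on the certificate only through `r` and `rhoD`. -/
theorem pU_congr (Ψ₁ : Cert RD CD) (hr : Ψ₁.r = Ψ.r) (hρ : Ψ₁.rhoD = Ψ.rhoD) (f : RD → CD → Z8) (tyR : RD → ℕ) (tyC : CD → ℕ) (tgt : ℕ)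
    (cols : List CD) : Ψ₁.pU f tyR tyC tgt cols = Ψ.pU f tyR tyC tgt cols := by
  cases Ψ₁
  cases Ψ
  simp only at hr hρ
  subst hr
  subst hρ
  rfl

/-- (U) IN TWO CHUNKS: a certificate `Ψ₁` carrying the same `r`, `rhoD` and the first `rows₁.length` rows of `W` checks the first chunk of rows,
the remaining rows of `W` are checked directly; together they give (U) for `Ψ` on `rows₁ ++ rows₂` (used to keep each data file small). -/
theorem validU_append (Ψ₁ : Cert RD CD) (hr : Ψ₁.r = Ψ.r) (hρ : Ψ₁.rhoD = Ψ.rhoD) {f : RD → CD → Z8} {tyR : RD → ℕ} {tyC : CD → ℕ}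
    {tgt : ℕ} {cols : List CD} (rows₁ rows₂ : List RD) (W₂ : List (ℤ × List (ℕ × Z8))) (hW : Ψ.W = Ψ₁.W ++ W₂)
    (hlen : rows₁.length = Ψ₁.W.length) (i₂ : ℕ) (hi : i₂ = rows₁.length)
    (h₁ : Ψ₁.validU f tyR tyC tgt rows₁ cols = true) (h₂ : allIx2 ((1 : ℤ), ([] : List (ℕ × Z8))) (Ψ.pU f tyR tyC tgt cols) i₂ rows₂ W₂ = true) :
    Ψ.validU f tyR tyC tgt (rows₁ ++ rows₂) cols = true := by
  unfold validU at h₁ ⊢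
  rw [hW]
  rw [pU_congr Ψ Ψ₁ hr hρ] at h₁
  subst hi
  exact allIx2_append _ _ 0 rows₁ Ψ₁.W rows₂ W₂ hlen h₁ (by simpa using h₂)

end Cert

end Summit.HodgeConjecture.HodgeConjecture.HodgeLocus.Census.Z8Cert

namespace Summit.HodgeConjecture.HodgeConjecture.HodgeLocus.Census.QDense

open PlaneSum Z8Cert TwistCells

/-! ## The stacked matrix [M_{δ₁} ; M_{δ₂}] as certificate data -/

/-- the 532 stacked data rows: (false, v) for the upper class, (true, v) for the lower class. -/
def rowsS : List (Bool × List ℕ) := idxL.map (Prod.mk false) ++ idxL.map (Prod.mk true)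

/-- the stacked entry function: upper rows evaluate the class L₁, lower rows L₂. -/
def fS (L₁ L₂ : List QPlane) (rd : Bool × List ℕ) (cd : List ℕ) : Z8 := entryQ (bif rd.1 then L₂ else L₁) (vfun rd.2 cd)

/-- the type of a stacked row is the type of its vector. -/
def tyS (rd : Bool × List ℕ) : ℕ := tyQ rd.2

/-- vanishing for the stacked entry function. -/
theorem fS_eq_zero_of_ty (L₁ L₂ : List QPlane) (h₁ : ∀ p ∈ L₁, blockStd p.mat = true) (h₂ : ∀ p ∈ L₂, blockStd p.mat = true)
    (rd : Bool × List ℕ) (cd : List ℕ) (h : tyS rd + tyQ cd ≠ 4) : fS L₁ L₂ rd cd = 0 := by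
  obtain ⟨s, v⟩ := rd
  cases s
  · exact fQ_eq_zero_of_ty L₁ h₁ v cd h
  · exact fQ_eq_zero_of_ty L₂ h₂ v cd h

/-- positional lookup in a mapped list (in range). -/
theorem lget_map {α β : Type*} (g : α → β) (d : α) (d' : β) : ∀ (l : List α) (k : ℕ), k < l.length → lget d' (l.map g) k = g (lget d l k)
  | [], _, hk => absurd hk (by simp)
  | _ :: _, 0, _ => rfl
  | _ :: l, k + 1, hk => lget_map g d d' l k (by simpa using hk)

/-- positional lookup in an appended list. -/
theorem lget_append {α : Type*} (d : α) : ∀ (l₁ l₂ : List α) (k : ℕ),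
    lget d (l₁ ++ l₂) k = if k < l₁.length then lget d l₁ k else lget d l₂ (k - l₁.length)
  | [], _, _ => by simp
  | _ :: _, _, 0 => by simp [lget]
  | x :: l₁, l₂, k + 1 => by
    rw [List.cons_append, lget, lget_append d l₁ l₂ k]
    simp only [List.length_cons, Nat.add_lt_add_iff_right, Nat.add_sub_add_right]
    rfl

/-- 532 stacked rows. -/
theorem rowsS_length : rowsS.length = 532 := by decide +kernel

/-- the upper rows … -/
theorem lget_rowsS_lt {a : ℕ} (ha : a < 266) : lget default rowsS a = (false, lget [] idxL a) := by
  unfold rowsS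
  rw [lget_append, List.length_map, idxL_length, if_pos ha, lget_map (Prod.mk false) [] _ idxL a (by rw [idxL_length]; exact ha)]

/-- … and the lower rows (written 266 + k so that no numeral subtraction is ever unfolded). -/
theorem lget_rowsS_add {k : ℕ} (hk : k < 266) : lget default rowsS (266 + k) = (true, lget [] idxL k) := by
  unfold rowsS
  rw [lget_append, List.length_map, idxL_length, if_neg (by omega), Nat.add_sub_cancel_left,
    lget_map (Prod.mk true) [] _ idxL k (by rw [idxL_length]; exact hk)]

/-- the stacked row index type reindexed by Fin 532. -/
noncomputable def eStack : Fin 532 ≃ (indexSet 6 4 (6 / 2 * 4 - 6 - 2)) ⊕ (indexSet 6 4 (6 / 2 * 4 - 6 - 2)) :=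
  (finSumFinEquiv (m := 266) (n := 266)).symm.trans (Equiv.sumCongr eRow eRow)

/-- STACKED PAIR: two class links and a valid typed certificate for `fS L₁ L₂` on rowsS × idxL decide rank [M_δ₁; M_δ₂] = r (characteristic 0,
ζ a primitive 8th root of unity) — i.e. codim (ker M_δ₁ ∩ ker M_δ₂) = r. -/
theorem stackRank_of_qcert (L₁ L₂ : List QPlane) (h₁ : ∀ p ∈ L₁, blockStd p.mat = true) (h₂ : ∀ p ∈ L₂, blockStd p.mat = true)
    (δ₁ δ₂ : List (ℚ × LinearCycle 6))
    (hE₁ : ∀ (K : Type) [Field K] (ζ : K), ζ ^ 4 = -1 → ∀ i : Fin 8 → ℕ, periodComb 6 4 ζ δ₁ i = Z8.eval ζ (entryQ L₁ (ext8 i)))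
    (hE₂ : ∀ (K : Type) [Field K] (ζ : K), ζ ^ 4 = -1 → ∀ i : Fin 8 → ℕ, periodComb 6 4 ζ δ₂ i = Z8.eval ζ (entryQ L₂ (ext8 i)))
    (Ψ : Z8Cert.Cert (Bool × List ℕ) (List ℕ)) (hV : Ψ.valid (fS L₁ L₂) tyS tyQ 4 rowsS idxL 532 266 = true) :
    ∀ (K : Type) [Field K] [CharZero K] (ζ : K), IsPrimitiveRoot ζ (2*4) →
      (Matrix.fromRows (ivhsMatrix 6 4 ζ δ₁) (ivhsMatrix 6 4 ζ δ₂)).rank = Ψ.r := by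
  intro K _ _ ζ hζ
  have h4 : ζ ^ 4 = -1 := zeta_pow_four_of_primitive hζ
  rw [← Matrix.rank_submatrix (Matrix.fromRows (ivhsMatrix 6 4 ζ δ₁) (ivhsMatrix 6 4 ζ δ₂)) eStack eIdx]
  refine Z8Cert.rank_eq_of_valid ζ h4 (fS_eq_zero_of_ty L₁ L₂ h₁ h₂) rowsS_length idxL_length hV _ fun a b => ?_
  rw [Matrix.submatrix_apply]
  by_cases ha : a.1 < 266
  · set x : Fin 266 := ⟨a.1, ha⟩ with hxdef
    have h1 : (finSumFinEquiv (m := 266) (n := 266)).symm a = Sum.inl x := by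
      rw [Equiv.symm_apply_eq]
      exact Fin.ext rfl
    have hx : eStack a = Sum.inl (eRow x) := by
      show (Equiv.sumCongr eRow eRow) ((finSumFinEquiv (m := 266) (n := 266)).symm a) = _
      rw [h1]
      rfl
    rw [hx, Matrix.fromRows_apply_inl, lget_rowsS_lt ha]
    unfold ivhsMatrix
    rw [hE₁ K ζ h4]
    show Z8.eval ζ (entryQ L₁ (ext8 fun e => idxV x e + idxV b e)) = Z8.eval ζ (entryQ L₁ (vfun (lget [] idxL a.1) (lget [] idxL b.1)))
    rfl
  · obtain ⟨k, hk⟩ : ∃ k, a.1 = 266 + k := ⟨a.1 - 266, by omega⟩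
    have hk' : k < 266 := by omega
    set x : Fin 266 := ⟨k, hk'⟩ with hxdef
    have h1 : (finSumFinEquiv (m := 266) (n := 266)).symm a = Sum.inr x := by
      rw [Equiv.symm_apply_eq]
      exact Fin.ext hk
    have hx : eStack a = Sum.inr (eRow x) := by
      show (Equiv.sumCongr eRow eRow) ((finSumFinEquiv (m := 266) (n := 266)).symm a) = _
      rw [h1]
      rfl
    have hrow : lget default rowsS a.1 = (true, lget [] idxL k) := by
      rw [hk]
      exact lget_rowsS_add hk'
    rw [hx, Matrix.fromRows_apply_inr, hrow]
    unfold ivhsMatrix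
    rw [hE₂ K ζ h4]
    show Z8.eval ζ (entryQ L₂ (ext8 fun e => idxV x e + idxV b e)) = Z8.eval ζ (entryQ L₂ (vfun (lget [] idxL k) (lget [] idxL b.1)))
    rfl

/-! ### Single signed planes (data shared by the stacked certificates) -/

/-- the standard plane P of X⁴₆ (matching id, no twists) as signed-plane data. -/
def planeStdL : List QPlane := [⟨1, [0, 1, 2, 3, 4, 5, 6, 7], [0, 0, 0, 0, 0, 0, 0, 0]⟩]

/-- the two-block plane P_two of X⁴₆ (matching (1 2)(5 6), sign +1, no twists) as signed-plane data. -/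
def planeTwoL : List QPlane := [⟨1, [0, 2, 1, 3, 4, 6, 5, 7], [0, 0, 0, 0, 0, 0, 0, 0]⟩]

/-- the twisted standard plane `standardPc 6 1 1` of X⁴₆ (matching id, twists a₅ = a₇ = 1) as signed-plane data. -/
def planeStdTwistL : List QPlane := [⟨1, [0, 1, 2, 3, 4, 5, 6, 7], [0, 0, 0, 0, 0, 1, 0, 1]⟩]

end Summit.HodgeConjecture.HodgeConjecture.HodgeLocus.Census.QDense
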